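import Literature.NumberTheory.IwasawaTheory.ClassGroupPRankLeOfNotElementaryLayerSubOne
import Literature.NumberTheory.IwasawaTheory.CyclotomicTwoLayerTwoNonNormUnit
import HarnessLib

/-!
# The elementary-layer door over a base with `ord₂ h_K = 1`, `p = 2`, IN CHEVALLEY'S CURRENCY: a unit `ε` of `K` whose SQUARE is outside `N_{K_2/K}K_2ˣ` (a class of order `4` in
# `E_K/(E_K ∩ N)` (`ε²` a non-norm — the depth `t = 2`) make `4 ∤ #Cl(K_2)^{Gal(K_2/K)}`; then `Cl(K_1)[2^∞]` NOT elementary abelian (or of rank `≤ 1`, or `8 ∣ h(K_1)`)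
# forces `rank₂ Cl(K_m) ≤ 1` for every `m`, `μ₂ = 0`, `λ₂ ≤ 1`

`Proofs`-style file (theorems only: no definition, no named fact, no instance, no `sorry`) in topic `NumberTheory/IwasawaTheory` (namespace = path), written by the
prover seat `bsd-line-att-p3` g47 (cell `bsd-f1-sign2`, route `AlignedTransportAtTwo`; `--supports` stmt-BirchSwinnertonDyer-22298, closes nothing; no class group is
computed here; BSD is not advanced by this file).  Sequel of `ClassGroupPRankLeOfNotElementaryLayerSubOne` (the door with the abstract ambiguous-class hypothesis) and of
att-p3 g46's `ClassGroupPRankLeOneOfNonNormUnitLayerTwo` / `CyclotomicTwoLayerTwoNonNormUnit` (Chevalley's count for the quartic layer, dyadic residues).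

* §1 `sq_dvd_relIndex_unitsNorm_of_pow_not_mem` — `L/K` Galois of degree `p^k`, a unit `u` of `K` with `u^p ∉ N Lˣ` ⟹ **`p² ∣ [E_K : E_K ∩ N Lˣ]`**
  (the coset of `u` has order divisible by `p²`).
* §2 `not_four_dvd_card_fixed_layer_two_of_sq_not_mem` — `κ` a `ℤ₂`-extension with Fukuda index `0`, `4 ∤ h_K`, exactly two ramified primes in `K_2`, a unit `u` of `K` with
  `u² ∉ N_{K_2/K}K_2ˣ` ⟹ **`4 ∤ #Cl(K_2)^{Gal(K_2/K)}`** (Chevalley: `#fix · 4 · idx = h_K · 16` with `4 ∣ idx`, so `#fix ∣ h_K`).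
* §3 ★★★ `classicalMuVanishes_two_of_layerOne_of_sq_not_mem` — `2 ∣ h_K`, `4 ∤ h_K` (`e_0 = 1`), the data of §2, and at the FIRST layer: `rank₂ Cl(K_1) < ord₂ h(K_1)`
  (non-elementary) OR `rank₂ Cl(K_1) ≤ 1` OR `8 ∣ h(K_1)` (i.e. `ord₂ h(K_1) ≠ 2` suffices) ⟹ **`rank₂ Cl(K_m) ≤ 1 ∀ m`, `μ₂ = 0`, `λ₂ ≤ 1`**;
  `…_of_not_dvd_discr` — the same for `K` of odd degree and odd discriminant with exactly two primes above `2`, `κ` cyclotomic, and a unit `ε ∈ 𝓞_Kˣ` with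
  **`ε² ∓ 1 ∉ 𝔭₁⁴`** at a dyadic prime `𝔭₁` of degree one (`2`-adic depth `t = 2`: `σ₁(ε) ≡ ±3 (mod 8)`, so `σ₁(ε²) ≡ 9 (mod 16)`), every datum in the base field
  except the layer-one class group.
CELL READING (bsd-f1-sign2): cubic `2`-torsion fields `ℚ(β)` with `Δ_W ≡ 5 (8)`, `h₂(ℚ(β)) = 2`, Chevalley class `t = 2` (u3/u5): `μ₂ > 0` would force
`Cl(ℚ(β,√2))[2^∞] ≅ (ℤ/2)²` EXACTLY; `ℤ/2 × ℤ/4`, `ℤ/8`, `ℤ/2`, … all give `μ₂ = 0`, `λ₂ ≤ 1`.  HONEST SCOPE: classical; BSD is not advanced.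
Not found in print in this form; ingredients cited at each use (D-0014).

References: [Lang1990] Ch. 13 §4 Lemma 4.1–4.2 (PDF pp. 203–204); [Gras2003] II.6.2.3, IV.4; [Washington1997] §13.1 Prop. 13.2, §13.3 Prop. 13.22–13.23;
[Fukuda1994] Thm. 1, p. 264; [NeukirchANT1999] Ch. III (2.12), Ch. VI §7 Thm. (7.1); [Omeara1963] §63B.
-/

set_option autoImplicit false

noncomputable section

open scoped NumberField
open NumberField IsDedekindDomain Field IntermediateField

namespace Literature.NumberTheory.IwasawaTheory

open Literature.NumberTheory.EllipticCurves Literature.NumberTheory.NumberFields Literature.NumberTheory.NumberFields.AmbiguousClass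
  Literature.NumberTheory.GaloisRepresentations Literature.NumberTheory.GaloisRepresentations.Herbrand
  Literature.NumberTheory.GaloisRepresentations.MinkowskiUnit Literature.NumberTheory.GaloisRepresentations.CyclicNormIndex

/-! ## §1 Two non-norm powers make the unit index divisible by `p²` (degree `p^k`) -/

section Index

variable {K L : Type} [Field K] [NumberField K] [Field L] [NumberField L] [Algebra K L]

/-- **`p² ∣ [E_K : E_K ∩ N_{L/K} Lˣ]` as soon as a unit `u` of `K` has `u^p ∉ N Lˣ`** (`L/K` Galois of degree `p^k`): the coset of `u` in
`E_K/(E_K ∩ N Lˣ)` is killed by `p^k` (`u^{[L:K]} = N_{L/K}(u)`, tree `pow_finrank_mem_map_norm`) and its `p`-th power is not trivial, so its order is `p^j`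
with `j ≥ 2`. [cite: Lang1990, Ch. 13 §4, Lemma 4.1 and proof of Lemma 4.2 (PDF pp. 203–204)] -/
theorem sq_dvd_relIndex_unitsNorm_of_pow_not_mem [IsGalois K L] {p k : ℕ} (hp : p.Prime) (hdeg : Module.finrank K L = p ^ k) {u : Lˣ}
    (hu : u ∈ unitsE L ⊓ (unitsIncl K L).range) (hnotp : u ^ p ∉ (⊤ : Subgroup Lˣ).map (Herbrand.norm (L ≃ₐ[K] L))) :
    p ^ 2 ∣ (unitsE L ⊓ (⊤ : Subgroup Lˣ).map (Herbrand.norm (L ≃ₐ[K] L))).relIndex (unitsE L ⊓ (unitsIncl K L).range) := by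
  classical
  haveI : Fact p.Prime := ⟨hp⟩
  set H := unitsE L ⊓ (⊤ : Subgroup Lˣ).map (Herbrand.norm (L ≃ₐ[K] L)) with hH
  set E := unitsE L ⊓ (unitsIncl K L).range with hE
  have hpowH : u ^ p ^ k ∈ H := by
    rw [← hdeg]; exact ⟨(unitsE L).pow_mem hu.1 _, pow_finrank_mem_map_norm hu.2⟩
  set q : E ⧸ H.subgroupOf E := QuotientGroup.mk ⟨u, hu⟩ with hq
  have hqp1 : q ^ p ≠ 1 := by
    intro h1
    rw [hq, ← QuotientGroup.mk_pow, QuotientGroup.eq_one_iff, Subgroup.mem_subgroupOf] at h1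
    exact hnotp h1.2
  have hqpk : q ^ p ^ k = 1 := by
    rw [hq, ← QuotientGroup.mk_pow, QuotientGroup.eq_one_iff, Subgroup.mem_subgroupOf]
    exact hpowH
  obtain ⟨j, -, hj⟩ := (Nat.dvd_prime_pow hp).mp (orderOf_dvd_of_pow_eq_one hqpk)
  have hj2 : 2 ≤ j := by
    by_contra hlt
    push Not at hlt
    apply hqp1
    have hdvd : orderOf q ∣ p := by
      rw [hj]
      interval_cases j
      · rw [pow_zero]; exact one_dvd _
      · rw [pow_one]
    exact orderOf_dvd_iff_pow_eq_one.mp hdvd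
  have hpq : p ^ 2 ∣ orderOf q := by rw [hj]; exact Nat.pow_dvd_pow p hj2
  rw [Subgroup.relIndex, Subgroup.index]
  exact hpq.trans (orderOf_dvd_natCard q)

end Index

/-! ## §2 Chevalley's count for `K_2/K` with unit index divisible by `4`: `4 ∤ #Cl(K_2)^G` when `4 ∤ h_K` -/

section Chevalley

variable {K : Type} [Field K] [NumberField K]

/-- **`4 ∤ #Cl(K_2)^{Gal(K_2/K)}` for a `ℤ₂`-extension with Fukuda index `0`, `4 ∤ h_K`, EXACTLY two primes of `K` ramified in `K_2`, and a unit `u` of `K` with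
`u² ∉ N_{K_2/K}K_2ˣ`** (then `u ∉ N` as well): Chevalley's formula reads `#Cl(K_2)^G · 4 · [E_K : E_K ∩ N] = h_K · 4²` (tree `ambiguousClassNumberFormula`,
`∏ e_𝔭 = 4²`, `e_∞ = 1`) with `4 ∣ [E_K : E_K ∩ N]` (§1), hence `#Cl(K_2)^G ∣ h_K`. [cite: Lang1990, Ch. 13 §4, Lemma 4.1 (PDF pp. 203–204)] [cite: Gras2003, II.6.2.3]
[cite: Washington1997, §13.1 Prop. 13.2] -/
theorem not_four_dvd_card_fixed_layer_two_of_sq_not_mem (κ : ZpExtension K 2) (hκ : TotallyRamifiedFrom κ 0) (hK : ¬ 4 ∣ classNumber K)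
    [NumberField (κ.layer 2)]
    (hs : {v : HeightOneSpectrum (𝓞 K) | v.asIdeal.ramificationIdxIn (𝓞 (κ.layer 2)) ≠ 1}.ncard = 2)
    {u : (κ.layer 2)ˣ} (hu : u ∈ unitsE (κ.layer 2) ⊓ (unitsIncl K (κ.layer 2)).range)
    (hnot2 : u ^ 2 ∉ (⊤ : Subgroup (κ.layer 2)ˣ).map (Herbrand.norm ((κ.layer 2) ≃ₐ[K] (κ.layer 2)))) :
    ¬ 4 ∣ Nat.card {c : ClassGroup (𝓞 (κ.layer 2)) //
      ∀ τ : (κ.layer 2) ≃ₐ[K] (κ.layer 2), ClassGroup.mulEquiv (intAut τ) c = c} := by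
  classical
  haveI : Fact (Nat.Prime 2) := ⟨Nat.prime_two⟩
  haveI : FiniteDimensional K (κ.layer 2) := κ.finiteDimensional_layer_holds 2
  haveI : IsGalois K (κ.layer 2) := κ.isGalois_layer_holds 2
  haveI : IsUnramifiedAtInfinitePlaces K (κ.layer 2) := κ.isUnramifiedAtInfinitePlaces_layer 2
  obtain ⟨ψ, -, hker, -⟩ := κ.exists_cyclicCharacter_layer 2
  haveI : IsCyclic ((κ.layer 2) ≃ₐ[K] (κ.layer 2)) := isCyclic_of_cyclicLayer ψ (κ.layer 2) hker
  obtain ⟨σ, hσ⟩ := IsCyclic.exists_generator (α := (κ.layer 2) ≃ₐ[K] (κ.layer 2))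
  have h := ambiguousClassNumberFormula hσ
  rw [κ.finrank_layer_holds 2, archFactor_eq_one, mul_one, finprod_ramificationIdxIn_layer_eq_pow κ hκ 2, hs] at h
  -- h : #fix * 2^2 * idx = h_K * (2^2)^2
  have hdeg : Module.finrank K (κ.layer 2) = 2 ^ 2 := κ.finrank_layer_holds 2
  obtain ⟨b, hb⟩ := sq_dvd_relIndex_unitsNorm_of_pow_not_mem Nat.prime_two hdeg hu hnot2
  rintro ⟨a, ha⟩
  rw [ha, hb] at h
  apply hK
  refine ⟨a * b, Nat.eq_of_mul_eq_mul_right (by norm_num : 0 < 16) ?_⟩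
  have h' : classNumber K * 16 = 4 * a * 2 ^ 2 * (2 ^ 2 * b) := by rw [h]; norm_num
  rw [h']; ring

/-! ## §3 The door at the first layer, `p = 2` -/

/-- ★★★ **THE ELEMENTARY-LAYER DOOR AT THE FIRST LAYER, `p = 2`, `ord₂ h_K = 1`.**  `κ` a `ℤ₂`-extension of `K` with Fukuda index `0`; `2 ∣ h_K`, `4 ∤ h_K`; exactly two
primes of `K` ramified in `K_2` and a unit `u` of `K` with `u² ∉ N_{K_2/K}K_2ˣ` (depth `t = 2`); and at the FIRST layer: `rank₂ Cl(K_1) < ord₂ h(K_1)` (the `2`-class group of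
`K_1` is NOT elementary abelian) OR `rank₂ Cl(K_1) < 2` OR `2 < ord₂ h(K_1)`.  THEN **`rank₂ Cl(K_m) ≤ 1` for every `m`, `μ₂(κ) = 0`, `λ₂(κ) ≤ 1`** — `μ₂ > 0` would force
`Cl(K_1)[2^∞] ≅ (ℤ/2)²` exactly. [cite: Washington1997, §13.3 Prop. 13.22–13.23] [cite: Lang1990, Ch. 13 §4, Lemma 4.1 (PDF pp. 203–204)] [cite: Fukuda1994, Thm. 1, p. 264] -/
theorem classicalMuVanishes_two_of_layerOne_of_sq_not_mem (κ : ZpExtension K 2) (hκ : TotallyRamifiedFrom κ 0)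
    (h2 : 2 ∣ classNumber K) (h4 : ¬ 4 ∣ classNumber K) [NumberField (κ.layer 2)]
    (hs : {v : HeightOneSpectrum (𝓞 K) | v.asIdeal.ramificationIdxIn (𝓞 (κ.layer 2)) ≠ 1}.ncard = 2)
    {u : (κ.layer 2)ˣ} (hu : u ∈ unitsE (κ.layer 2) ⊓ (unitsIncl K (κ.layer 2)).range)
    (hnot2 : u ^ 2 ∉ (⊤ : Subgroup (κ.layer 2)ˣ).map (Herbrand.norm ((κ.layer 2) ≃ₐ[K] (κ.layer 2))))
    (hk : classGroupPRank κ 1 < classNumberPExp κ 1 ∨ classGroupPRank κ 1 < 2 ∨ 2 < classNumberPExp κ 1) :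
    (∀ m, classGroupPRank κ m ≤ 1) ∧ ClassicalMuVanishes κ ∧ classicalLambda κ ≤ 1 := by
  haveI : Fact (Nat.Prime 2) := ⟨Nat.prime_two⟩
  haveI : FiniteDimensional K (κ.layer 2) := κ.finiteDimensional_layer_holds 2
  -- `e_0 = 1`
  have h0 : classNumberPExp κ 0 = 1 := by
    rw [classNumberPExp_zero_eq_padicValNat_classNumber]
    have hne : classNumber K ≠ 0 := classNumber_ne_zero K
    have h1 : 1 ≤ padicValNat 2 (classNumber K) := (padicValNat_dvd_iff_le (p := 2) hne).mp (by simpa using h2)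
    have h2' : ¬ 2 ≤ padicValNat 2 (classNumber K) := fun h =>
      h4 (by have h' := (padicValNat_dvd_iff_le (p := 2) hne).mpr h; simpa using h')
    omega
  -- the ambiguous-class hypothesis at layer `2 = 0 + (1 + 1)`
  have hfix' := not_four_dvd_card_fixed_layer_two_of_sq_not_mem κ hκ h4 hs hu hnot2
  have hfix : ¬ 2 ^ 2 ∣ Nat.card {c : ClassGroup (𝓞 (κ.layer (0 + (1 + 1)))) //
      ∀ τ : (κ.layer (0 + (1 + 1))) ≃ₐ[K] (κ.layer (0 + (1 + 1))),
        (∀ y : κ.layer (0 + (1 + 1)), ((y : κ.layer (0 + (1 + 1))) : AlgebraicClosure K) ∈ κ.layer 0 → τ y = y) →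
          ClassGroup.mulEquiv (AmbiguousClass.intAut τ) c = c} := by
    have hcard := card_fixed_layer_eq κ 2
    have e : (0 + (1 + 1) : ℕ) = 2 := by norm_num
    rw [show (2 : ℕ) ^ 2 = 4 by norm_num]
    simpa only [e] using (show ¬ 4 ∣ Nat.card {c : ClassGroup (𝓞 (κ.layer 2)) //
      ∀ τ : (κ.layer 2) ≃ₐ[K] (κ.layer 2),
        (∀ y : κ.layer 2, ((y : κ.layer 2) : AlgebraicClosure K) ∈ κ.layer 0 → τ y = y) →
          ClassGroup.mulEquiv (AmbiguousClass.intAut τ) c = c} by rw [hcard]; exact hfix')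
  have hk' : classGroupPRank κ (0 + 1) < classNumberPExp κ (0 + 1) ∨ classGroupPRank κ (0 + 1) < 2 ^ 1 ∨ 2 ^ 1 < classNumberPExp κ (0 + 1) := by
    simpa only [Nat.zero_add, pow_one] using hk
  have hr := classGroupPRank_add_le_of_not_sq_dvd_card_fixed κ hκ le_rfl h0 (k := 1) hfix hk'
  have hμ := classicalMuVanishes_and_classicalLambda_le_of_not_sq_dvd_card_fixed κ hκ le_rfl h0 (k := 1) hfix hk'
  simp only [Nat.zero_add, pow_one] at hr hμ
  exact ⟨fun m => by have := hr m; omega, hμ.1, by have := hμ.2; omega⟩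

/-- ★★★ **The same from BASE-FIELD DATA** for `K` of ODD degree with `2 ∤ d_K` and EXACTLY two primes above `2` (cubic `2`-torsion fields with `Δ_W ≡ 5 (8)`), `κ` cyclotomic:
`2 ∣ h_K`, `4 ∤ h_K`; a maximal ideal `𝔭₁ ∋ 2` with `𝓞_K/𝔭₁ = 𝔽₂`; a unit `ε ∈ 𝓞_Kˣ` with **`ε² ∓ 1 ∉ 𝔭₁⁴`** (so `ε² ∉ N_{K_2/K}K_2ˣ`, tree
`unitsIncl_unitsMap_not_mem_map_norm_layer_two`); and `rank₂ Cl(K_1) < ord₂ h(K_1)` or `rank₂ Cl(K_1) ≤ 1` or `ord₂ h(K_1) ≥ 3` ⟹ `rank₂ Cl(K_m) ≤ 1 ∀ m`, `μ₂ = 0`, `λ₂ ≤ 1`.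
[cite: Washington1997, §13.3 Prop. 13.22–13.23] [cite: Lang1990, Ch. 13 §4, Lemma 4.1] [cite: NeukirchANT1999, Ch. III (2.12), Ch. V §1] [cite: Fukuda1994, Thm. 1, p. 264] -/
theorem classicalMuVanishes_two_of_layerOne_of_not_mem_pow_four_of_not_dvd_discr (hKdeg : ¬ 2 ∣ Module.finrank ℚ K)
    (hd : ¬ (2 : ℤ) ∣ NumberField.discr K) (κ : ZpExtension K 2) (hκ : κ.IsCyclotomic)
    (h2card : {w : HeightOneSpectrum (𝓞 K) | ((2 : ℕ) : 𝓞 K) ∈ w.asIdeal}.ncard = 2)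
    (h2 : 2 ∣ classNumber K) (h4 : ¬ 4 ∣ classNumber K) [NumberField (κ.layer 2)]
    (P : Ideal (𝓞 K)) [P.IsMaximal] (hres : ∀ r : 𝓞 K, r ∈ P ∨ r - 1 ∈ P) (h2P : (2 : 𝓞 K) ∈ P) (h2P' : (2 : 𝓞 K) ∉ P ^ 2)
    (ε : (𝓞 K)ˣ) (hε3 : (ε : 𝓞 K) ^ 2 - 1 ∉ P ^ 4) (hε4 : (ε : 𝓞 K) ^ 2 + 1 ∉ P ^ 4)
    (hk : classGroupPRank κ 1 < classNumberPExp κ 1 ∨ classGroupPRank κ 1 < 2 ∨ 2 < classNumberPExp κ 1) :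
    (∀ m, classGroupPRank κ m ≤ 1) ∧ ClassicalMuVanishes κ ∧ classicalLambda κ ≤ 1 := by
  have hP0 : P ≠ ⊥ := fun h0 => by
    rw [h0, Ideal.mem_bot] at h2P
    exact two_ne_zero h2P
  have hodd := forall_odd_ramificationIdx_of_not_dvd_discr hd
  have hram : TotallyRamifiedFrom κ 0 := totallyRamifiedFrom_zero_of_forall_odd_ramificationIdx hKdeg κ hκ hodd
  have hs : {v : HeightOneSpectrum (𝓞 K) | v.asIdeal.ramificationIdxIn (𝓞 (κ.layer 2)) ≠ 1}.ncard = 2 := by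
    rw [ncard_ramified_layer_eq_ncard_dyadic hKdeg κ hκ hodd one_le_two, h2card]
  have hnot2' := unitsIncl_unitsMap_not_mem_map_norm_layer_two hKdeg κ hκ P hP0 hres h2P h2P' (ε ^ 2)
    (by rw [Units.val_pow_eq_pow_val]; exact hε3) (by rw [Units.val_pow_eq_pow_val]; exact hε4)
  have hnot2 : (unitsIncl K (κ.layer 2) (Units.map (algebraMap (𝓞 K) K : 𝓞 K →* K) ε)) ^ 2 ∉
      (⊤ : Subgroup (κ.layer 2)ˣ).map (Herbrand.norm ((κ.layer 2) ≃ₐ[K] (κ.layer 2))) := by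
    rw [← map_pow, ← map_pow]; exact hnot2'
  exact classicalMuVanishes_two_of_layerOne_of_sq_not_mem κ hram h2 h4 hs (unitsIncl_unitsMap_mem_unitsE_inf_range ε) hnot2 hk

end Chevalley

end Literature.NumberTheory.IwasawaTheory

end
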